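import Literature.Probability.FitznerVanDerHofstad2017.NbwChebyshevBound
import Literature.Probability.FitznerVanDerHofstad2017.NbwLawFourier
import HarnessLib

/-!
# The closed-form (Chebyshev) NBW bounds at the tree's NBW polynomials `nbwPoly`

Specialises the closed-form Chebyshev bounds and the table-only `J_n` corollaries of
`NbwChebyshevBound.lean` to the NBW polynomials `nbwPoly d m` of `NbwLawFourier.lean`
(`b̂_m = P_m(2d D̂)`, `nbwP_eq_card_nbwWordsTo`), and gives a rational envelope of the bulk
constant `nbwBulkBound` (replace `√(2d-1)` by any `s ≥ √(2d-1)`) for certificate readers.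
Kernel facts only; nothing is quoted from [NoBLE17]/[FvdH17].  (`isNbwPolySeq_nbwPoly` carries the name
planned for it in the b2b-lace N68c-G (iv) junction module, which imports this file.)
-/

noncomputable section

open Real Polynomial

namespace Literature.Probability.FitznerVanDerHofstad2017

variable {d : ℕ}

/-- The tree's NBW polynomials satisfy the NBW recursion interface (by their defining equations).
[folklore] -/
theorem isNbwPolySeq_nbwPoly (d : ℕ) : IsNbwPolySeq d (nbwPoly d) :=
  ⟨rfl, rfl, rfl, fun _ => rfl⟩

/-- (L2) for `P_m`: `|A| ≤ 2√(2d-1) → |P_m(A)| ≤ B(m)`. [folklore] -/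
theorem abs_eval_nbwPoly_le (hd : 1 ≤ d) {A : ℝ} (hA : |A| ≤ 2 * √(2 * (d : ℝ) - 1)) (m : ℕ) :
    |(nbwPoly d m).eval A| ≤ nbwBulkBound d m :=
  (isNbwPolySeq_nbwPoly d).abs_eval_le_nbwBulkBound hd hA m

/-- (L3) for `P_m`: `2√(2d-1) ≤ A → 0 ≤ P_m(A)`. [folklore] -/
theorem nbwPoly_eval_nonneg_of_le (hd : 1 ≤ d) {A : ℝ} (hA : 2 * √(2 * (d : ℝ) - 1) ≤ A)
    (m : ℕ) : 0 ≤ (nbwPoly d m).eval A :=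
  (isNbwPolySeq_nbwPoly d).eval_nonneg_of_le hd hA m

/-- Parity `P_m(-A) = (-1)^m P_m(A)`. [folklore] -/
theorem nbwPoly_eval_neg (A : ℝ) (m : ℕ) :
    (nbwPoly d m).eval (-A) = (-1) ^ m * (nbwPoly d m).eval A :=
  (isNbwPolySeq_nbwPoly d).eval_neg A m

/-- `-Π_i B(c_i) ≤ (Π_i P_{c_i})(A)` for every real `A`, `Σ c` even. [folklore] -/
theorem neg_prod_nbwBulkBound_le_eval_nbwPoly (hd : 1 ≤ d) (c : List ℕ) (hc : Even c.sum)
    (A : ℝ) : -((c.map (nbwBulkBound d)).prod) ≤ ((c.map (nbwPoly d)).prod).eval A :=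
  (isNbwPolySeq_nbwPoly d).neg_prod_bound_le_eval hd c hc A

/-- Table-only bound of the NBW-kernel remainder of an even composition:
`J_n(Π_i P_{c_i}) ≤ Σ_j [Π_i P_{c_i}]_j (2d)^j I_{n,j}(0) + 2 Π_i B(c_i) · I_{n,0}(0)`. [folklore] -/
theorem nbwJ_nbwPoly_prod_le {n : ℕ} (hdn : 2 * n + 1 ≤ d) (c : List ℕ) (hc : Even c.sum) :
    nbwJ d n (c.map (nbwPoly d)).prod ≤
      (∑ j ∈ Finset.range ((c.map (nbwPoly d)).prod.natDegree + 1),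
          ((c.map (nbwPoly d)).prod).coeff j * (2 * (d : ℝ)) ^ j * srwI d n j 0)
        + (2 * (c.map (nbwBulkBound d)).prod) * srwI d n 0 0 :=
  (isNbwPolySeq_nbwPoly d).nbwJ_prod_le hdn c hc

/-- The same for the `e₁`-type kernel `(Π_i P_{c_i})·X/(2d)` of an odd composition. [folklore] -/
theorem nbwJ_nbwPoly_prod_e1_le {n : ℕ} (hdn : 2 * n + 1 ≤ d) (c : List ℕ) (hc : Odd c.sum) :
    nbwJ d n ((c.map (nbwPoly d)).prod * C (1 / (2 * (d : ℝ))) * X) ≤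
      (∑ j ∈ Finset.range (((c.map (nbwPoly d)).prod * C (1 / (2 * (d : ℝ))) * X).natDegree + 1),
          ((c.map (nbwPoly d)).prod * C (1 / (2 * (d : ℝ))) * X).coeff j * (2 * (d : ℝ)) ^ j
            * srwI d n j 0)
        + (2 * ((c.map (nbwBulkBound d)).prod * (√(2 * (d : ℝ) - 1) / d))) * srwI d n 0 0 :=
  (isNbwPolySeq_nbwPoly d).nbwJ_prod_e1_le hdn c hc

/-- Rational envelope of the bulk constant: for any `s ≥ √(2d-1)`,
`B(m) ≤ s^m (m+1) + s^{m-2} (m-1)`. [folklore] -/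
theorem nbwBulkBound_le_of_sqrt_le {s : ℝ} (hs : √(2 * (d : ℝ) - 1) ≤ s) (m : ℕ) :
    nbwBulkBound d m ≤ s ^ m * ((m : ℝ) + 1) + s ^ (m - 2) * ((m - 1 : ℕ) : ℝ) := by
  have h0 : 0 ≤ √(2 * (d : ℝ) - 1) := Real.sqrt_nonneg _
  unfold nbwBulkBound
  gcongr

/-- … and of a product of bulk constants. [folklore] -/
theorem prod_nbwBulkBound_le_of_sqrt_le {s : ℝ} (hs : √(2 * (d : ℝ) - 1) ≤ s) (c : List ℕ) :
    (c.map (nbwBulkBound d)).prod ≤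
      (c.map fun m : ℕ => s ^ m * ((m : ℝ) + 1) + s ^ (m - 2) * ((m - 1 : ℕ) : ℝ)).prod := by
  induction c with
  | nil => simp
  | cons a l ih =>
    simp only [List.map_cons, List.prod_cons]
    have ha := nbwBulkBound_le_of_sqrt_le hs a
    have hl0 : 0 ≤ (l.map (nbwBulkBound d)).prod :=
      List.prod_nonneg fun x hx => by
        obtain ⟨i, -, rfl⟩ := List.mem_map.1 hx; exact nbwBulkBound_nonneg d i
    exact mul_le_mul ha ih hl0 ((nbwBulkBound_nonneg d a).trans ha)

end Literature.Probability.FitznerVanDerHofstad2017
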